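import Mathlib
import Summits.NavierStokesRegularity.NavierStokesRegularity.Theses.ParabolicDriftLiouville
import HarnessLib

/-!
# `ParabolicDriftLiouville.Assembly` — the route's assembly (item stmt-NavierStokesRegularity-19505;
  pure logic)

**Statement.** `ParabolicDriftLiouville → DiagonalContainment → NoTypeII → the Clay statement`.

PROOF. The route file `Theses/ParabolicDriftLiouville.lean` carries the planner-authored,
kernel-checked deciding theorem `Theses.ParabolicDriftLiouville.closes`, whose hypotheses are
exactly the route's items and whose conclusion is the registered leaf; the assembly item is that
implication written as ONE proposition, so it is closed by applying `closes` to the hypotheses.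

HONEST FRAMING: glue between the route's own statements (about HYPOTHETICAL objects); nothing
here bears on the regularity problem itself.
-/

noncomputable section

set_option linter.dupNamespace false

namespace Summit.NavierStokesRegularity.NavierStokesRegularity.Theorems

open Summit.NavierStokesRegularity.NavierStokesRegularity.Theses.ParabolicDriftLiouville in
/-- **Item stmt-NavierStokesRegularity-19505** (`ParabolicDriftLiouville.Assembly`): the route's
chain of items implies its registered leaf, by the route file's deciding theorem `closes`. [this
file] -/
theorem parabolicDriftLiouville_assembly_proof :
    Summit.NavierStokesRegularity.NavierStokesRegularity.Theses.ParabolicDriftLiouville.Assembly := by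
  unfold Summit.NavierStokesRegularity.NavierStokesRegularity.Theses.ParabolicDriftLiouville.Assembly
  intro h₁ h₂ h₃
  exact closes h₁ h₂ h₃

end Summit.NavierStokesRegularity.NavierStokesRegularity.Theorems

end
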